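import Summits.BirchSwinnertonDyer.Rank1Residual.GaloisImage.SmallImageAbelianInertia
import Literature.NumberTheory.EllipticCurves.Rank1Residual.GVParityTwistTransportProofs
import HarnessLib

/-!
# The determinant reads an ordinary-type line (`σ|_L = χ̄_p(σ)` when `σ` is trivial on `E[p]/L`),
# and `χ₋₃ = ω` (`σ√−3 = √−3 ↔ χ̄₃(σ) = 1`) — part 1 of TB-TOL
# (cell `b2b-bsdres`, lane CLASS-CLOSURE, seat cc-typer-1 = typer of record N11 / O8; task TB-TOL of
# `class-closure/O8/STATEMENT.md` §13; sequel `Additive/TwistedOrdinaryLineOfTwist.lean`)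

HONEST FRAMING (cell `b2b-bsdres`, run/shared/lean/b2b/bsd-rank1-residual/, verbatim in every
file): the goal of the cell is to DELETE the COMBINATION-SHAPED residual classes of the
Birch–Swinnerton-Dyer formula for ALL analytic-rank `≤ 1` elliptic curves over `ℚ` — "full BSD
formula for every rank `≤ 1` curve in class `C`" assembled STRICTLY from published theorems — so
that the rank-`≤ 1` remainder becomes exactly the CONSTRUCTION-SHAPED classes, which are TYPED
(missing-input `Prop`s), NOT attempted. This is not "finishing BSD". Lane CLASS-CLOSURE: research
routes, no claim beyond the stated classes; census output = EVIDENCE, never a Literature fact;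
NOTHING is booked here. THEOREMS ONLY: no definition, no named fact, no conjecture, no `sorry`.

## What is proved

* §1 `smul_eq_cyclotomic_zsmul_of_forall_sub_mem` — **the determinant reads the stable line.** For
  `σ ∈ Γ_ℚ` and a line `L ≤ E[p]` with `(σ − 1)E[p] ⊆ L` (so `σ` is trivial on `E[p]/L`: the
  unramified-quotient / Tate-line situation at an inertia element), `σ` acts on `L` by the scalar
  `det ρ̄_{E,p}(σ) = χ̄_p(σ)` (Weil pairing, tree `det_frame_galoisRepTorsion_eq'` in a frame
  `exists_frame_galoisRepTorsion_rat`; the `2 × 2` identity `det M · det[u w] = det[Mu Mw]` done by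
  hand over `𝔽_p`, `u = e(x₀)`, `x₀ ∈ L`, `w = e(q₀)`, `q₀ ∉ L`).
* §2 `smul_geomSqrt_neg_three_iff` — **`χ₋₃ = ω` at `p = 3`:** `σ√−3 = √−3 ↔ χ̄₃(σ) = 1`
  (`√−3 = ±(2ζ₃ + 1)` and `σζ₃ = ζ₃^{χ̄₃(σ)}`); `val_modPCyclotomicCharacterZMod_three_eq_two`:
  `χ̄₃(σ) ≠ 1 ⟹ χ̄₃(σ) = 2 (= −1)`.

These are the two inputs of TB-TOL (sequel): on `W = C • V^{(−3)}` the line transported from the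
unramified-quotient line of `V[3]` is FIXED by inertia because the Kummer sign `χ₋₃(σ)` and the
scalar `χ̄₃(σ)` cancel. Nothing about BSD_p; nothing booked.

References: J.-P. Serre, Invent. Math. 15 (1972) §1.11 (det ρ̄ = cyclotomic character)
[Serre1972]; class-closure/O8/STATEMENT.md §13.
-/

set_option autoImplicit false

noncomputable section

open scoped Classical NumberField Matrix

open WeierstrassCurve Literature.NumberTheory.EllipticCurves Literature.NumberTheory.GaloisRepresentations
  Field IsDedekindDomain NumberField
  Literature.NumberTheory.EllipticCurves.Rank1Residual
  Summit.BirchSwinnertonDyer.Rank1Residual.GaloisImage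

namespace Summit.BirchSwinnertonDyer.Rank1Residual.Additive.MixedCongruence

variable {W : WeierstrassCurve ℚ} [W.IsElliptic] {p : ℕ} [Fact p.Prime]

/-! ## §1. The determinant reads the stable line: `σ|_L = χ̄_p(σ)` when `σ` is trivial on `E[p]/L` -/

omit [W.IsElliptic] in
/-- A line of `E[p]` is generated by any of its non-zero elements. [folklore] -/
theorem zmultiples_eq_of_mem_of_ne_zero {L : AddSubgroup (geomTorsion W (p : ℤ))}
    (hL : Nat.card L = p) {x₀ : geomTorsion W (p : ℤ)} (hx₀L : x₀ ∈ L) (hx₀ : x₀ ≠ 0) :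
    AddSubgroup.zmultiples x₀ = L := by
  have hp : p.Prime := Fact.out
  have hord : addOrderOf x₀ = p :=
    addOrderOf_eq_prime (by rw [← natCast_zsmul]; exact natCast_zsmul_eq_zero x₀) hx₀
  have hM : Nat.card (AddSubgroup.zmultiples x₀) = p := by rw [Nat.card_zmultiples, hord]
  haveI : Finite L := Nat.finite_of_card_ne_zero (by rw [hL]; exact hp.ne_zero)
  exact AddSubgroup.eq_of_le_of_card_ge (AddSubgroup.zmultiples_le.mpr hx₀L) (by rw [hL, hM])

variable (W p) in
/-- **`σ` acts on a line with trivial quotient by the scalar `χ̄_p(σ)`.** Let `L ≤ E[p]` be a line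
and `σ ∈ Γ_ℚ` with `σ • P − P ∈ L` for all `P` (unramified-quotient / Tate-line situation). Then
`σ • P = χ̄_p(σ) • P` for `P ∈ L`: in a frame `E[p] ≅ 𝔽_p²` the matrix `M` of `σ` and the vectors
`u = e(x₀)` (`x₀ ∈ L`), `w = e(q₀)` (`q₀ ∉ L`) satisfy `Mu = a u`, `Mw = w + t u`, so
`det M · (u₀w₁ − u₁w₀) = a · (u₀w₁ − u₁w₀)` with `u₀w₁ − u₁w₀ ≠ 0`, and `det M = χ̄_p(σ)` by the Weil
pairing (`det_frame_galoisRepTorsion_eq'`, Serre 1972 §1.11). [cite: Serre1972, §1.11] -/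
theorem smul_eq_cyclotomic_zsmul_of_forall_sub_mem (σ : absoluteGaloisGroup ℚ)
    {L : AddSubgroup (geomTorsion W (p : ℤ))} (hL : Nat.card L = p)
    (hsub : ∀ P : geomTorsion W (p : ℤ), σ • P - P ∈ L) {P : geomTorsion W (p : ℤ)} (hP : P ∈ L) :
    σ • P = (((modPCyclotomicCharacterZMod ℚ p σ : (ZMod p)ˣ) : ZMod p).val : ℤ) • P := by
  have hp : p.Prime := Fact.out
  have hst : ∀ Q ∈ L, σ • Q ∈ L := fun Q hQ ↦ by
    have h : σ • Q = (σ • Q - Q) + Q := by abel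
    rw [h]
    exact L.add_mem (hsub Q) hQ
  obtain ⟨a, ha⟩ := exists_int_forall_mem_smul_eq_zsmul hL hst
  -- it suffices to identify `a` with `χ̄_p(σ)` in `𝔽_p`
  suffices hkey : ((a : ℤ) : ZMod p) = ((modPCyclotomicCharacterZMod ℚ p σ : (ZMod p)ˣ) : ZMod p) by
    rw [ha P hP]
    have h1 : ((a - (((modPCyclotomicCharacterZMod ℚ p σ : (ZMod p)ˣ) : ZMod p).val : ℤ) : ℤ) :
        ZMod p) = 0 := by
      rw [Int.cast_sub, hkey, Int.cast_natCast, ZMod.natCast_zmod_val, sub_self]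
    obtain ⟨m, hm⟩ := (ZMod.intCast_zmod_eq_zero_iff_dvd _ p).mp h1
    rw [← sub_eq_zero, ← sub_smul, hm, mul_comm, ← smul_smul, natCast_zsmul_eq_zero, smul_zero]
  -- a frame, a generator `x₀` of `L` and a point `q₀` outside `L`
  obtain ⟨e, Φ, he, -, hdetχ, -, -⟩ := exists_frame_galoisRepTorsion_rat W p
  have hLbot : L ≠ ⊥ := by
    intro h
    have h1 : Nat.card L = 1 := by rw [h]; exact AddSubgroup.card_bot
    exact hp.one_lt.ne' (hL.symm.trans h1)
  obtain ⟨⟨x₀, hx₀L⟩, hx₀⟩ := (AddSubgroup.ne_bot_iff_exists_ne_zero).mp hLbot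
  have hx₀' : (x₀ : geomTorsion W (p : ℤ)) ≠ 0 := fun h ↦ hx₀ (Subtype.ext h)
  obtain ⟨q₀, hq₀⟩ := exists_not_mem_of_natCard_eq hL
  have hLeq := zmultiples_eq_of_mem_of_ne_zero hL hx₀L hx₀'
  obtain ⟨t, ht⟩ : ∃ t : ℤ, t • x₀ = σ • q₀ - q₀ :=
    AddSubgroup.mem_zmultiples_iff.mp (hLeq.symm ▸ hsub q₀)
  -- the matrix `M` of `σ` and the vectors `u = e x₀`, `w = e q₀`
  set M : Matrix (Fin 2) (Fin 2) (ZMod p) :=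
    ((Φ (galoisRepTorsion W p σ) : GL (Fin 2) (ZMod p)) : Matrix (Fin 2) (Fin 2) (ZMod p)) with hM
  set u : Fin 2 → ZMod p := e x₀ with hu
  set w : Fin 2 → ZMod p := e q₀ with hw
  have heσ : ∀ Q : geomTorsion W (p : ℤ), e (σ • Q) = M *ᵥ e Q := fun Q ↦ by
    rw [hM, ← he, galoisRepTorsion_apply]
  have hMu : M *ᵥ u = (a : ZMod p) • u := by
    rw [hu, ← heσ, ha x₀ hx₀L, map_zsmul, Int.cast_smul_eq_zsmul]
  have hMw : M *ᵥ w = w + (t : ZMod p) • u := by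
    rw [hw, hu, ← heσ, show σ • q₀ = q₀ + t • x₀ by rw [ht, add_sub_cancel], map_add, map_zsmul,
      Int.cast_smul_eq_zsmul]
  -- componentwise
  have hrow : ∀ (v : Fin 2 → ZMod p) (i : Fin 2), (M *ᵥ v) i = M i 0 * v 0 + M i 1 * v 1 :=
    fun v i ↦ by simp [Matrix.mulVec, dotProduct, Fin.sum_univ_two]
  have E1 : M 0 0 * u 0 + M 0 1 * u 1 = a * u 0 := by
    have h := congrFun hMu 0; rwa [hrow, Pi.smul_apply, smul_eq_mul] at h
  have E2 : M 1 0 * u 0 + M 1 1 * u 1 = a * u 1 := by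
    have h := congrFun hMu 1; rwa [hrow, Pi.smul_apply, smul_eq_mul] at h
  have E3 : M 0 0 * w 0 + M 0 1 * w 1 = w 0 + t * u 0 := by
    have h := congrFun hMw 0; rwa [hrow, Pi.add_apply, Pi.smul_apply, smul_eq_mul] at h
  have E4 : M 1 0 * w 0 + M 1 1 * w 1 = w 1 + t * u 1 := by
    have h := congrFun hMw 1; rwa [hrow, Pi.add_apply, Pi.smul_apply, smul_eq_mul] at h
  -- `det M · D = a · D` with `D = u₀ w₁ − u₁ w₀`
  have hdet : M.det * (u 0 * w 1 - u 1 * w 0) = (a : ZMod p) * (u 0 * w 1 - u 1 * w 0) := by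
    rw [Matrix.det_fin_two]
    linear_combination (M 1 0 * w 0 + M 1 1 * w 1) * E1 - (M 0 0 * w 0 + M 0 1 * w 1) * E2 +
      ((a : ZMod p) * u 0) * E4 - ((a : ZMod p) * u 1) * E3
  -- `D ≠ 0`: otherwise `w ∈ 𝔽_p u`, i.e. `q₀ ∈ L`
  have hu0 : u ≠ 0 := by
    intro h
    apply hx₀'
    apply e.injective
    rw [← hu, h, map_zero]
  have hD : u 0 * w 1 - u 1 * w 0 ≠ 0 := by
    intro hD
    -- find `c` with `w = c • u`
    obtain ⟨c, hc⟩ : ∃ c : ZMod p, w = c • u := by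
      by_cases h0 : u 0 = 0
      · have h1 : u 1 ≠ 0 := by
          intro h1
          apply hu0
          ext i
          fin_cases i
          · exact h0
          · exact h1
        have hw0 : w 0 = 0 := by
          have : u 1 * w 0 = 0 := by rw [h0, zero_mul, zero_sub, neg_eq_zero] at hD; exact hD
          exact (mul_eq_zero.mp this).resolve_left h1
        refine ⟨w 1 / u 1, ?_⟩
        ext i
        fin_cases i
        · simp [h0, hw0]
        · simp [div_mul_cancel₀ _ h1]
      · refine ⟨w 0 / u 0, ?_⟩
        ext i
        fin_cases i
        · simp [div_mul_cancel₀ _ h0]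
        · simp only [Fin.isValue, Fin.mk_one, Pi.smul_apply, smul_eq_mul]
          rw [sub_eq_zero] at hD
          field_simp
          linear_combination hD
    apply hq₀
    have hq : q₀ = (c.val : ℤ) • x₀ := by
      apply e.injective
      rw [map_zsmul, ← hu, ← hw, hc, ← Int.cast_smul_eq_zsmul (ZMod p), Int.cast_natCast,
        ZMod.natCast_zmod_val]
    rw [hq]
    exact L.zsmul_mem hx₀L _
  have hdetM : M.det = (a : ZMod p) := mul_right_cancel₀ hD hdet
  -- `det M = χ̄_p(σ)` (Weil pairing)
  have hχ : M.det = ((modPCyclotomicCharacterZMod ℚ p σ : (ZMod p)ˣ) : ZMod p) := by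
    rw [hM, ← Matrix.GeneralLinearGroup.val_det_apply, hdetχ σ]
  rw [← hdetM, hχ]


/-! ## §2. `χ₋₃ = ω`: the Kummer sign of `Γ_ℚ` on `√−3` is the mod-`3` cyclotomic character -/

/-- **`σ√−3 = √−3 ↔ χ̄₃(σ) = 1`.** With `ζ` a primitive cube root of unity in `ℚ̄`,
`s = 2ζ + 1` has `s² = −3`, and `σζ = ζ^{χ̄₃(σ)}` gives `σs = s` if `χ̄₃(σ) = 1`, `σs = −s` if
`χ̄₃(σ) = 2` (`2ζ² + 1 = −s`); `√−3 = ±s`. So the quadratic character of `ℚ(√−3) = ℚ(μ₃)` is the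
mod-`3` cyclotomic character. [folklore] -/
theorem smul_geomSqrt_neg_three_iff (σ : absoluteGaloisGroup ℚ) :
    σ • geomSqrt (-3 : ℚ) = geomSqrt (-3 : ℚ) ↔ modPCyclotomicCharacterZMod ℚ 3 σ = 1 := by
  obtain ⟨ζ, hζ⟩ := HasEnoughRootsOfUnity.prim (M := AlgebraicClosure ℚ) (n := 3)
  have hζ3 : ζ ^ 3 = 1 := hζ.pow_eq_one
  have hζ1 : ζ ≠ 1 := hζ.ne_one (by norm_num)
  have hζ0 : ζ ≠ 0 := by
    intro h
    rw [h] at hζ3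
    norm_num at hζ3
  have hquad : ζ ^ 2 + ζ + 1 = 0 := by
    have h : (ζ - 1) * (ζ ^ 2 + ζ + 1) = 0 := by
      rw [show (ζ - 1) * (ζ ^ 2 + ζ + 1) = ζ ^ 3 - 1 by ring, hζ3, sub_self]
    exact (mul_eq_zero.mp h).resolve_left (sub_ne_zero.mpr hζ1)
  -- `s = 2ζ + 1` is a square root of `-3`
  have hs2 : (2 * ζ + 1) ^ 2 = geomSqrt (-3 : ℚ) ^ 2 := by
    rw [geomSqrt_sq, map_neg, map_ofNat]
    linear_combination (4 : AlgebraicClosure ℚ) * hquad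
  have h2 : σ • (2 : AlgebraicClosure ℚ) = 2 := by
    rw [show (2 : AlgebraicClosure ℚ) = 1 + 1 by norm_num, smul_add, smul_one]
  have hσs : σ • (2 * ζ + 1) = 2 * σ • ζ + 1 := by
    rw [smul_add, smul_mul', h2, smul_one]
  have hspec := modPCyclotomicCharacterZMod_spec ℚ 3 σ ζ hζ3
  set χ := modPCyclotomicCharacterZMod ℚ 3 σ with hχdef
  have hk3 : ((χ : (ZMod 3)ˣ) : ZMod 3).val < 3 := ZMod.val_lt _
  have hk0 : ((χ : (ZMod 3)ˣ) : ZMod 3).val ≠ 0 := fun h0 ↦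
    (χ : (ZMod 3)ˣ).ne_zero ((ZMod.val_eq_zero _).mp h0)
  have hiff : χ = 1 ↔ ((χ : (ZMod 3)ˣ) : ZMod 3).val = 1 := by
    constructor
    · intro h
      rw [h, Units.val_one, ZMod.val_one]
    · intro h
      apply Units.ext
      rw [Units.val_one, ← ZMod.natCast_zmod_val ((χ : (ZMod 3)ˣ) : ZMod 3), h, Nat.cast_one]
  have key : σ • (2 * ζ + 1) = 2 * ζ + 1 ↔ ((χ : (ZMod 3)ˣ) : ZMod 3).val = 1 := by
    constructor
    · intro h
      by_contra hne
      have hk2 : ((χ : (ZMod 3)ˣ) : ZMod 3).val = 2 := by omega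
      rw [hσs, hspec, hk2] at h
      -- `h : 2 * ζ ^ 2 + 1 = 2 * ζ + 1`
      have h2ne : (2 : AlgebraicClosure ℚ) ≠ 0 := by
        rw [← map_ofNat (algebraMap ℚ (AlgebraicClosure ℚ)) 2]
        exact (map_ne_zero _).mpr two_ne_zero
      have hA : ζ ^ 2 - ζ = 0 := by
        have hB : (2 : AlgebraicClosure ℚ) * (ζ ^ 2 - ζ) = 0 := by linear_combination h
        exact (mul_eq_zero.mp hB).resolve_left h2ne
      have hC : ζ * (ζ - 1) = 0 := by linear_combination hA
      rcases mul_eq_zero.mp hC with h0 | h1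
      · exact hζ0 h0
      · exact hζ1 (sub_eq_zero.mp h1)
    · intro h
      rw [hσs, hspec, h, pow_one]
  rw [hiff, ← key]
  rcases sq_eq_sq_iff_eq_or_eq_neg.mp hs2.symm with h | h
  · rw [h]
  · rw [h, smul_neg, neg_inj]

/-- `χ̄₃(σ) ≠ 1 ⟹ χ̄₃(σ).val = 2` (the only other unit of `𝔽₃`). [folklore] -/
theorem val_modPCyclotomicCharacterZMod_three_eq_two {σ : absoluteGaloisGroup ℚ}
    (h : modPCyclotomicCharacterZMod ℚ 3 σ ≠ 1) :
    ((modPCyclotomicCharacterZMod ℚ 3 σ : (ZMod 3)ˣ) : ZMod 3).val = 2 := by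
  set χ := modPCyclotomicCharacterZMod ℚ 3 σ
  have hk3 : ((χ : (ZMod 3)ˣ) : ZMod 3).val < 3 := ZMod.val_lt _
  have hk0 : ((χ : (ZMod 3)ˣ) : ZMod 3).val ≠ 0 := fun h0 ↦
    (χ : (ZMod 3)ˣ).ne_zero ((ZMod.val_eq_zero _).mp h0)
  have hk1 : ((χ : (ZMod 3)ˣ) : ZMod 3).val ≠ 1 := by
    intro h1
    apply h
    apply Units.ext
    rw [Units.val_one, ← ZMod.natCast_zmod_val ((χ : (ZMod 3)ˣ) : ZMod 3), h1, Nat.cast_one]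
  omega

end Summit.BirchSwinnertonDyer.Rank1Residual.Additive.MixedCongruence

end
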